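import Summits.KontsevichZagierPeriods.KontsevichZagierPeriods.Theorems.ValuedFieldSpecialisationClassLevelExpansionFibreDimOneToolkit
import Summits.KontsevichZagierPeriods.KontsevichZagierPeriods.Theorems.ValuedFieldSpecialisationParametricLiftingFrullaniDilation

/-!
# Route ValuedFieldSpecialisation — crux `ParametricLifting`: the Frullani sector, fibre splits

Stub `frullani_splits` of the Frullani calibration of the crux `ParametricLifting`
(stmt-KontsevichZagierPeriods-3498). Over the base `G = {0 < s, 2 s < 1}` (parameter `s = z 0`),
with fibre variable `t = z 1` and all domains bands `KZlog.band G a b = {s ∈ G, a s ≤ t ≤ b s}`,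
the big family `A₂ = ({s ≤ t ≤ 2}, 1/(t(1+t)))` RESTRICTS to

* `A = ({s ≤ t ≤ 1}, 1/(t(1+t)))`, `B' = ({2s ≤ t ≤ 2}, 1/(t(1+t)))`,
* `K = ({s ≤ t ≤ 2s}, ·)`, `M = ({2s ≤ t ≤ 1}, ·)`, `N = ({1 ≤ t ≤ 2}, ·)` (same integrand),

and the two FIBRE SPLITS at `t = 2s` and at `t = 1`,

  `[A] − [K] − [M] ∈ KZ.fibredRelations`,  `[B'] − [M] − [N] ∈ KZ.fibredRelations`,

are instances of additivity in the domain (a fibred generator) with Lebesgue-null overlaps (a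
subset of the graph `t = 2s` over `G`, resp. of the hyperplane `t = 1`). The generic fact is
`frullani_splits_of_sub_of_restrict_band_mem`: splitting a representation over a band
`{a ≤ t ≤ c}` at an intermediate `ℚ`-semialgebraic edge `b`, `a ≤ b ≤ c`, is a fibred move.
(The semialgebraicity of the base `G` is `frullani_dilation_isSemialgebraic_base` of the companion
file on the fibred dilation.)

Sources: M. Kontsevich, D. Zagier, *Periods* (2001), §1.2 rule (1) (additivity); the fibred
calculus is this project's (route ValuedFieldSpecialisation). No new definitions.
-/

noncomputable section

namespace Summit.KontsevichZagierPeriods.ValuedFieldSpecialisation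

open MeasureTheory Set Filter MvPolynomial
open scoped Topology
open Literature.NumberTheory.Transcendental Literature.NumberTheory.Transcendental.KZ
open Literature.ModelTheory.ExponentialFields (IsSemialgebraic isSemialgebraic_setOf_eval_pos
  isSemialgebraic_setOf_eval_lt isSemialgebraic_setOf_eval_le)

variable {n : ℕ}

/-! ### Splitting a band at an intermediate edge -/

/-- A band splits at an intermediate edge: over `τ`, `{a ≤ t ≤ c} = {a ≤ t ≤ b} ∪ {b ≤ t ≤ c}`
whenever `a ≤ b ≤ c` on `τ`. [folklore] -/
theorem frullani_splits_band_eq_union {τ : Set (Fin n → ℝ)} {a b c : (Fin n → ℝ) → ℝ}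
    (hab : ∀ x ∈ τ, a x ≤ b x) (hbc : ∀ x ∈ τ, b x ≤ c x) :
    KZlog.band τ a c = KZlog.band τ a b ∪ KZlog.band τ b c := by
  ext z
  simp only [KZlog.mem_band, mem_union]
  constructor
  · rintro ⟨hτ, ha, hc⟩
    rcases le_total (z (Fin.last n)) (b (Fin.init z)) with h | h
    · exact Or.inl ⟨hτ, ha, h⟩
    · exact Or.inr ⟨hτ, h, hc⟩
  · rintro (⟨hτ, ha, hb⟩ | ⟨hτ, hb, hc⟩)
    · exact ⟨hτ, ha, hb.trans (hbc _ hτ)⟩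
    · exact ⟨hτ, (hab _ hτ).trans hb, hc⟩

/-- Two adjacent bands `{a ≤ t ≤ b}`, `{b ≤ t ≤ c}` over `τ` overlap inside the graph of the common
edge `b` over `τ`, a Lebesgue-null set when `b` is `ℚ`-semialgebraic on `τ`
(`KZ.volume_graph_eq_zero`). [folklore] -/
theorem frullani_splits_volume_band_inter_band {τ : Set (Fin n → ℝ)} {a b c : (Fin n → ℝ) → ℝ}
    (hb : IsSemialgebraicFunOn ℚ τ b) :
    volume (KZlog.band τ a b ∩ KZlog.band τ b c) = 0 := by
  refine measure_mono_null (fun z hz => ?_) (volume_graph_eq_zero hb)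
  exact ⟨hz.1.1, le_antisymm hz.1.2.2 hz.2.2.1⟩

/-- **Splitting a band representation at an intermediate semialgebraic edge is a fibred move.**
If `r` lives on the band `{a ≤ t ≤ c}` over `τ` and `a ≤ b ≤ c` on `τ` with `a`, `b`, `c`
`ℚ`-semialgebraic on `τ`, then `[r] − [r|{a ≤ t ≤ b}] − [r|{b ≤ t ≤ c}] ∈ KZ.fibredRelations`
(additivity in the domain, the overlap lying in the null graph of `b`).
[Kontsevich–Zagier 2001, §1.2 rule (1)] [folklore] -/
theorem frullani_splits_of_sub_of_restrict_band_mem (r : IntegralRep (n + 1))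
    {τ : Set (Fin n → ℝ)} {a b c : (Fin n → ℝ) → ℝ}
    (ha : IsSemialgebraicFunOn ℚ τ a) (hb : IsSemialgebraicFunOn ℚ τ b)
    (hc : IsSemialgebraicFunOn ℚ τ c) (hab : ∀ x ∈ τ, a x ≤ b x) (hbc : ∀ x ∈ τ, b x ≤ c x)
    (hr : r.domain = KZlog.band τ a c) (hl : KZlog.band τ a b ⊆ r.domain)
    (hu : KZlog.band τ b c ⊆ r.domain) :
    of r - of (r.restrict (KZlog.band τ a b) (KZlog.isSemialgebraic_band ha hb) hl) -
      of (r.restrict (KZlog.band τ b c) (KZlog.isSemialgebraic_band hb hc) hu) ∈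
        fibredRelations :=
  of_sub_of_restrict_sub_of_restrict_mem_fibredRelations r (KZlog.isSemialgebraic_band ha hb)
    (KZlog.isSemialgebraic_band hb hc) (hr.trans (frullani_splits_band_eq_union hab hbc))
    (frullani_splits_volume_band_inter_band hb)

/-! ### The two fibre splits -/

/-- **Stub D of the Frullani calibration (the fibre splits at `t = 2s` and `u = 1`).** Given the
big family `A₂ = ({0 < s, 2s < 1, s ≤ t ≤ 2}, 1/(t(1+t)))`, its restrictions
`A = A₂|{s ≤ t ≤ 1}`, `B' = A₂|{2s ≤ t ≤ 2}`, `K = A₂|{s ≤ t ≤ 2s}`, `M = A₂|{2s ≤ t ≤ 1}`,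
`N = A₂|{1 ≤ t ≤ 2}` are integral representations with the displayed band domains and the same
integrand, and `[A] − [K] − [M]`, `[B'] − [M] − [N]` are fibred relations: additivity in the
domain along the fibre, the overlaps `{t = 2s}`, `{t = 1}` being null.
[Kontsevich–Zagier 2001, §1.2 rule (1)] [folklore] -/
theorem frullani_splits :
    ∀ (A₂ : KZ.IntegralRep (1 + 1)), A₂.domain = KZlog.band {y : Fin 1 → ℝ | 0 < y 0 ∧ 2 * y 0 < 1} (fun y => y 0) (fun _ => 2) → (A₂.integrand = fun z => (z 1 * (1 + z 1))⁻¹) → ∃ A B' K M N : KZ.IntegralRep (1 + 1), A.domain = KZlog.band {y : Fin 1 → ℝ | 0 < y 0 ∧ 2 * y 0 < 1} (fun y => y 0) (fun _ => 1) ∧ (A.integrand = fun z => (z 1 * (1 + z 1))⁻¹) ∧ B'.domain = KZlog.band {y : Fin 1 → ℝ | 0 < y 0 ∧ 2 * y 0 < 1} (fun y => 2 * y 0) (fun _ => 2) ∧ (B'.integrand = fun z => (z 1 * (1 + z 1))⁻¹) ∧ K.domain = KZlog.band {y : Fin 1 → ℝ | 0 < y 0 ∧ 2 * y 0 < 1}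 (fun y => y 0) (fun y => 2 * y 0) ∧ (K.integrand = fun z => (z 1 * (1 + z 1))⁻¹) ∧ M.domain = KZlog.band {y : Fin 1 → ℝ | 0 < y 0 ∧ 2 * y 0 < 1} (fun y => 2 * y 0) (fun _ => 1) ∧ (M.integrand = fun z => (z 1 * (1 + z 1))⁻¹) ∧ N.domain = KZlog.band {y : Fin 1 → ℝ | 0 < y 0 ∧ 2 * y 0 < 1} (fun _ => 1) (fun _ => 2) ∧ (N.integrand = fun z => (z 1 * (1 + z 1))⁻¹) ∧ KZ.of A - KZ.of K - KZ.of M ∈ KZ.fibredRelations ∧ KZ.of B' - KZ.of M - KZ.of N ∈ KZ.fibredRelations := by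
  intro A₂ hA₂d hA₂i
  -- the base `G = {0 < s, 2s < 1}` (`frullani_dilation_isSemialgebraic_base`, Frullani dilation
  -- file) and the edges `s`, `2s`, `1`, `2` are `ℚ`-semialgebraic
  have hG : IsSemialgebraic ℚ {y : Fin 1 → ℝ | 0 < y 0 ∧ 2 * y 0 < 1} :=
    frullani_dilation_isSemialgebraic_base
  have hs : IsSemialgebraicFunOn ℚ {y : Fin 1 → ℝ | 0 < y 0 ∧ 2 * y 0 < 1} (fun y => y 0) := by
    simpa using isSemialgebraicFunOn_aeval hG (X 0)
  have h2s : IsSemialgebraicFunOn ℚ {y : Fin 1 → ℝ | 0 < y 0 ∧ 2 * y 0 < 1}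
      (fun y => 2 * y 0) :=
    (isSemialgebraicFunOn_aeval hG (C 2 * X 0)).congr fun y _ => by simp
  have h1 : IsSemialgebraicFunOn ℚ {y : Fin 1 → ℝ | 0 < y 0 ∧ 2 * y 0 < 1}
      (fun _ => (1 : ℝ)) := by
    simpa using isSemialgebraicFunOn_ratCast hG 1
  have h2 : IsSemialgebraicFunOn ℚ {y : Fin 1 → ℝ | 0 < y 0 ∧ 2 * y 0 < 1}
      (fun _ => (2 : ℝ)) := by
    simpa using isSemialgebraicFunOn_ratCast hG 2
  -- the edges are ordered `s ≤ 2s ≤ 1 ≤ 2` over `G`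
  have hs2s : ∀ y ∈ {y : Fin 1 → ℝ | 0 < y 0 ∧ 2 * y 0 < 1}, y 0 ≤ 2 * y 0 :=
    fun y hy => by linarith [hy.1]
  have h2s1 : ∀ y ∈ {y : Fin 1 → ℝ | 0 < y 0 ∧ 2 * y 0 < 1}, 2 * y 0 ≤ (1 : ℝ) :=
    fun y hy => hy.2.le
  have h12 : ∀ y ∈ {y : Fin 1 → ℝ | 0 < y 0 ∧ 2 * y 0 < 1}, (1 : ℝ) ≤ 2 :=
    fun _ _ => one_le_two
  -- the sub-bands `V = {s ≤ t ≤ 1}`, `V' = {2s ≤ t ≤ 2}` of the big band, and `K ⊆ V ⊇ M`,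
  -- `M ⊆ V' ⊇ N`
  have hV : IsSemialgebraic ℚ
      (KZlog.band {y : Fin 1 → ℝ | 0 < y 0 ∧ 2 * y 0 < 1} (fun y => y 0) (fun _ => 1)) :=
    KZlog.isSemialgebraic_band hs h1
  have hV' : IsSemialgebraic ℚ
      (KZlog.band {y : Fin 1 → ℝ | 0 < y 0 ∧ 2 * y 0 < 1} (fun y => 2 * y 0) (fun _ => 2)) :=
    KZlog.isSemialgebraic_band h2s h2
  have hK : IsSemialgebraic ℚ
      (KZlog.band {y : Fin 1 → ℝ | 0 < y 0 ∧ 2 * y 0 < 1} (fun y => y 0) (fun y => 2 * y 0)) :=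
    KZlog.isSemialgebraic_band hs h2s
  have hM : IsSemialgebraic ℚ
      (KZlog.band {y : Fin 1 → ℝ | 0 < y 0 ∧ 2 * y 0 < 1} (fun y => 2 * y 0) (fun _ => 1)) :=
    KZlog.isSemialgebraic_band h2s h1
  have hN : IsSemialgebraic ℚ
      (KZlog.band {y : Fin 1 → ℝ | 0 < y 0 ∧ 2 * y 0 < 1} (fun _ => 1) (fun _ => 2)) :=
    KZlog.isSemialgebraic_band h1 h2
  have hVsub : KZlog.band {y : Fin 1 → ℝ | 0 < y 0 ∧ 2 * y 0 < 1} (fun y => y 0) (fun _ => 1) ⊆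
      A₂.domain := by
    rw [hA₂d]
    rintro z ⟨hz, ha, hb⟩
    exact ⟨hz, ha, hb.trans one_le_two⟩
  have hV'sub : KZlog.band {y : Fin 1 → ℝ | 0 < y 0 ∧ 2 * y 0 < 1} (fun y => 2 * y 0) (fun _ => 2) ⊆
      A₂.domain := by
    rw [hA₂d]
    rintro z ⟨hz, ha, hb⟩
    exact ⟨hz, (hs2s _ hz).trans ha, hb⟩
  have hKV : KZlog.band {y : Fin 1 → ℝ | 0 < y 0 ∧ 2 * y 0 < 1} (fun y => y 0) (fun y => 2 * y 0) ⊆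
      KZlog.band {y : Fin 1 → ℝ | 0 < y 0 ∧ 2 * y 0 < 1} (fun y => y 0) (fun _ => 1) := by
    rintro z ⟨hz, ha, hb⟩
    exact ⟨hz, ha, hb.trans (h2s1 _ hz)⟩
  have hMV : KZlog.band {y : Fin 1 → ℝ | 0 < y 0 ∧ 2 * y 0 < 1} (fun y => 2 * y 0) (fun _ => 1) ⊆
      KZlog.band {y : Fin 1 → ℝ | 0 < y 0 ∧ 2 * y 0 < 1} (fun y => y 0) (fun _ => 1) := by
    rintro z ⟨hz, ha, hb⟩
    exact ⟨hz, (hs2s _ hz).trans ha, hb⟩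
  have hMV' : KZlog.band {y : Fin 1 → ℝ | 0 < y 0 ∧ 2 * y 0 < 1} (fun y => 2 * y 0) (fun _ => 1) ⊆
      KZlog.band {y : Fin 1 → ℝ | 0 < y 0 ∧ 2 * y 0 < 1} (fun y => 2 * y 0) (fun _ => 2) := by
    rintro z ⟨hz, ha, hb⟩
    exact ⟨hz, ha, hb.trans one_le_two⟩
  have hNV' : KZlog.band {y : Fin 1 → ℝ | 0 < y 0 ∧ 2 * y 0 < 1} (fun _ => 1) (fun _ => 2) ⊆
      KZlog.band {y : Fin 1 → ℝ | 0 < y 0 ∧ 2 * y 0 < 1} (fun y => 2 * y 0) (fun _ => 2) := by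
    rintro z ⟨hz, ha, hb⟩
    exact ⟨hz, (h2s1 _ hz).trans ha, hb⟩
  -- all five families are restrictions of `A₂`; the two `M`'s (`A|M` and `B'|M`) coincide
  refine ⟨A₂.restrict _ hV hVsub, A₂.restrict _ hV' hV'sub,
    (A₂.restrict _ hV hVsub).restrict _ hK hKV, (A₂.restrict _ hV hVsub).restrict _ hM hMV,
    (A₂.restrict _ hV' hV'sub).restrict _ hN hNV', rfl, hA₂i, rfl, hA₂i, rfl, hA₂i, rfl, hA₂i,
    rfl, hA₂i, ?_, ?_⟩
  · exact frullani_splits_of_sub_of_restrict_band_mem _ hs h2s h1 hs2s h2s1 rfl hKV hMV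
  · exact frullani_splits_of_sub_of_restrict_band_mem _ h2s h1 h2 h2s1 h12 rfl hMV' hNV'

end Summit.KontsevichZagierPeriods.ValuedFieldSpecialisation
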